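import Summits.CriticalPhenomena.PercolationContinuityZ3.Theorems.PercNearOneGluingNoHeavyPcintBSMBlocks
import Summits.CriticalPhenomena.PercolationContinuityZ3.Theorems.PercNearOneGluingNoHeavyPcintOSMSiteBridge
import HarnessLib

/-!
# PCINT lane, PHASE 5 (block-renewal second moment), step 5: block paths in `ℤ^{k+t}` and the bridge to bond percolation

Cell `prim-pcint`, seat `prim-pcint-1` (gen 14); memo `run/shared/lean/prim/pcint/T-FIBRE-ROUTE.md` §PHASE 5.

A block word `β : Fin n → Blk np k` is drawn in `ℤ^{k+t} = ℤ^k × ℤ^t` (`BSM.ι`): block `j` starts at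
`posB β j = Σ_{i<j} (e a_i, pend σ_i)`, runs through its transverse piece and ends with the step `+e_{a_j}`.  Its edges are
the global keys `Eglob pc β` (block start time, local key), read as lattice edges by the injective `BSM.gedge`.  Since the
time coordinates of block `j` sum to `j`, the keys of different blocks are disjoint and two words share exactly
`|Eglob β ∩ Eglob β'| = Ksh Rloc pc 0 β β'` keys (`BSM.card_inter_Eglob`).  If all keys of a block word are open, the
origin is joined by an open lattice path to the start of every block (`BSM.pathIn_blocks`); the arm event and the
second moment are taken in …BSMMoments.
-/

noncomputable section

namespace Summit.CriticalPhenomena.PercolationContinuityZ3.Theorems.Pcint.BSM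

open Finset OSM AdaptDom EdgeExpl Literature.Probability.Percolation Literature.Probability.LatticeModels

variable {t k np : ℕ}

/-! ### Coordinates -/

/-- The site of `ℤ^{k+t}` with time coordinates `q.1` and transverse coordinates `q.2`. -/
def ι (q : Off t k) : Site (k + t) := Fin.append q.1 q.2

/-- `ι` is additive. -/
theorem ι_add (q q' : Off t k) : ι (q + q') = ι q + ι q' := by
  funext i
  refine Fin.addCases (fun j => ?_) (fun j => ?_) i
  · simp [ι, Fin.append_left]
  · simp [ι, Fin.append_right]

/-- `ι 0 = 0`. -/
theorem ι_zero : ι (0 : Off t k) = 0 := by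
  funext i
  refine Fin.addCases (fun j => ?_) (fun j => ?_) i
  · simp [ι, Fin.append_left]
  · simp [ι, Fin.append_right]

/-- `ι` is injective. -/
theorem ι_injective : Function.Injective (ι : Off t k → Site (k + t)) := by
  intro q q' h
  refine Prod.ext (funext fun j => ?_) (funext fun j => ?_)
  · have := congr_fun h (Fin.castAdd t j); simpa [ι, Fin.append_left] using this
  · have := congr_fun h (Fin.natAdd k j); simpa [ι, Fin.append_right] using this

/-- The coordinate sum splits. -/
theorem sum_ι (q : Off t k) : ∑ i, ι q i = ∑ a, q.1 a + ∑ l, q.2 l := by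
  rw [Fin.sum_univ_add]
  simp [ι, Fin.append_left, Fin.append_right]

/-- The displacement vector of an axis: transverse `inl i ↦ (0, e_i)`, time `inr a ↦ (e_a, 0)`. -/
def axisVec : Fin t ⊕ Fin k → Off t k
  | Sum.inl i => (0, Pi.single i 1)
  | Sum.inr a => (e a, 0)

/-- `ι (axisVec ax)` is a unit coordinate vector of `ℤ^{k+t}`. -/
theorem ι_axisVec (ax : Fin t ⊕ Fin k) :
    ι (axisVec ax : Off t k) = Pi.single (Sum.elim (fun i => Fin.natAdd k i) (fun a => Fin.castAdd t a) ax) 1 := by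
  funext i
  cases ax with
  | inl l =>
    refine Fin.addCases (fun j => ?_) (fun j => ?_) i
    · have hne : (Fin.castAdd t j : Fin (k + t)) ≠ Fin.natAdd k l := by
        intro h; have := congr_arg Fin.val h; simp at this; omega
      simp [ι, axisVec, Fin.append_left, hne]
    · by_cases h : j = l
      · subst h; simp [ι, axisVec, Fin.append_right]
      · have hne : (Fin.natAdd k j : Fin (k + t)) ≠ Fin.natAdd k l := fun hh => h (Fin.ext (by
          have := congr_arg Fin.val hh; simp at this; omega))
        simp [ι, axisVec, Fin.append_right, hne, h]
  | inr a =>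
    refine Fin.addCases (fun j => ?_) (fun j => ?_) i
    · by_cases h : j = a
      · subst h; simp [ι, axisVec, e, Fin.append_left]
      · have hne : (Fin.castAdd t j : Fin (k + t)) ≠ Fin.castAdd t a := fun hh => h (Fin.ext (by
          have := congr_arg Fin.val hh; simpa using this))
        simp [ι, axisVec, e, Fin.append_left, hne, h]
    · have hne : (Fin.natAdd k j : Fin (k + t)) ≠ Fin.castAdd t a := by
        intro h; have := congr_arg Fin.val h; simp at this; omega
      simp [ι, axisVec, e, Fin.append_right, hne]

/-- The coordinate sum of an axis vector is `1`. -/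
theorem sum_ι_axisVec (ax : Fin t ⊕ Fin k) : ∑ i, ι (axisVec ax : Off t k) i = 1 := by
  rw [ι_axisVec, Finset.sum_pi_single']
  simp

/-! ### Global edge keys and lattice edges -/

/-- Global edge keys: the start time of the block and a local key. -/
abbrev GKey (t k : ℕ) := (Fin k → ℤ) × LKey t k

/-- The lattice edge of a global key `(T, (u, ax))`: from `ι (T, u)` along the axis `ax`. -/
def gedge (g : GKey t k) : Sym2 (Site (k + t)) := s(ι (g.1, g.2.1), ι (g.1, g.2.1) + ι (axisVec g.2.2))

/-- `gedge` is injective. -/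
theorem gedge_injective : Function.Injective (gedge : GKey t k → Sym2 (Site (k + t))) := by
  rintro ⟨T, u, ax⟩ ⟨T', u', ax'⟩ h
  unfold gedge at h
  simp only at h
  have hidx : ∀ a b : Fin t ⊕ Fin k, Sum.elim (fun i => Fin.natAdd k i) (fun a => Fin.castAdd t a) a =
      Sum.elim (fun i => Fin.natAdd k i) (fun a => Fin.castAdd t a) b → a = b := by
    rintro (i | a) (j | b) hh <;> simp only [Sum.elim_inl, Sum.elim_inr] at hh <;>
      have hv := congr_arg Fin.val hh <;> simp at hv
    · rw [Fin.ext hv]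
    · omega
    · omega
    · rw [Fin.ext hv]
  have hax : ∀ {a b : Fin t ⊕ Fin k}, ι (axisVec a : Off t k) = ι (axisVec b) → a = b := by
    intro a b hab
    rw [ι_axisVec, ι_axisVec] at hab
    apply hidx
    by_contra hne
    have := congr_fun hab (Sum.elim (fun i => Fin.natAdd k i) (fun a => Fin.castAdd t a) a)
    rw [Pi.single_eq_same, Pi.single_eq_of_ne hne] at this
    exact one_ne_zero this
  rcases Sym2.eq_iff.1 h with ⟨h1, h2⟩ | ⟨h1, h2⟩
  · have hb : (T, u) = (T', u') := ι_injective h1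
    rw [h1] at h2
    have hax' := hax (add_left_cancel h2)
    simp only [Prod.mk.injEq] at hb
    exact Prod.ext hb.1 (Prod.ext hb.2 hax')
  · exfalso
    have hsum : ι (axisVec ax : Off t k) + ι (axisVec ax') = 0 := by
      have : ι (T, u) + ι (axisVec ax) + ι (axisVec ax') = ι (T, u) := by rw [h2, ← h1]
      have := congr_arg (fun z => z - ι (T, u)) this
      simpa [add_assoc] using this
    have := congr_arg (fun z : Site (k + t) => ∑ j, z j) hsum
    simp only [Pi.add_apply, sum_add_distrib, sum_ι_axisVec, Pi.zero_apply, sum_const_zero] at this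
    norm_num at this

/-- The lattice edges of global keys are edges of `ℤ^{k+t}`. -/
theorem gedge_mem (g : GKey t k) : gedge g ∈ (zdGraph (k + t)).edgeSet := by
  rw [gedge, SimpleGraph.mem_edgeSet, zdGraph_adj_iff]
  exact ⟨_, Or.inl (by rw [ι_axisVec])⟩

/-- Adjacency along a global key. -/
theorem adj_gedge (g : GKey t k) : (zdGraph (k + t)).Adj (ι (g.1, g.2.1)) (ι (g.1, g.2.1) + ι (axisVec g.2.2)) :=
  (zdGraph_adj_iff _ _).2 ⟨_, Or.inl (by rw [ι_axisVec])⟩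

/-! ### Block paths -/

/-- The displacement of one block of a single walker. -/
def dsp (pc : Fin np → List (Fin t × Bool)) (b : Blk np k) : Off t k := (e b.2, pend (pc b.1))

/-- The start (time, transverse position) of block `j` of a block word. -/
def posB (pc : Fin np → List (Fin t × Bool)) {n : ℕ} (β : Fin n → Blk np k) (j : ℕ) : Off t k :=
  ∑ i : Fin n, if (i : ℕ) < j then dsp pc (β i) else 0

/-- The pair offset is the difference of the positions. -/
theorem offAt_zero_eq (pc : Fin np → List (Fin t × Bool)) {n : ℕ} (β β' : Fin n → Blk np k) (j : ℕ) :
    offAt pc 0 β β' j = posB pc β' j - posB pc β j := by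
  unfold offAt posB
  rw [zero_add, ← sum_sub_distrib]
  refine sum_congr rfl fun i _ => ?_
  split_ifs
  · rfl
  · simp

/-- The time coordinates of the start of block `j ≤ n` sum to `j`. -/
theorem sum_posB_fst (pc : Fin np → List (Fin t × Bool)) {n : ℕ} (β : Fin n → Blk np k) {j : ℕ} (hj : j ≤ n) :
    ∑ a, (posB pc β j).1 a = j := by
  unfold posB
  simp only [Prod.fst_sum, Finset.sum_apply, apply_ite Prod.fst, Prod.fst_zero, ite_apply, Pi.zero_apply, dsp]
  rw [sum_comm]
  have h1 : ∀ i : Fin n, ∑ a : Fin k, (if (i : ℕ) < j then e (β i).2 a else 0) = if (i : ℕ) < j then (1 : ℤ) else 0 := by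
    intro i
    split_ifs with h
    · simp [e, Finset.sum_pi_single']
    · simp
  simp_rw [h1]
  rw [Fin.sum_univ_eq_sum_range (fun i => if i < j then (1 : ℤ) else 0) n, ← Finset.sum_range_add_sum_Ico _ hj]
  have h2 : ∑ i ∈ range j, (if i < j then (1 : ℤ) else 0) = j := by
    rw [sum_congr rfl (fun i hi => if_pos (mem_range.1 hi))]; simp
  have h3 : ∑ i ∈ Ico j n, (if i < j then (1 : ℤ) else 0) = 0 :=
    sum_eq_zero fun i hi => if_neg (not_lt.2 (mem_Ico.1 hi).1)
  rw [h2, h3, add_zero]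

/-! ### Global keys of a block word -/

/-- The embedding of the local keys of a block started at time position `T`, transverse position `X`. -/
def embed (T : Fin k → ℤ) (X : Fin t → ℤ) : LKey t k ↪ GKey t k :=
  ⟨fun q => (T, (q.1 + X, q.2)), fun q q' h => by
    simp only [Prod.mk.injEq, add_left_inj, true_and] at h; exact Prod.ext h.1 h.2⟩

/-- The global keys of block `j` of the word `β`. -/
def Ej (pc : Fin np → List (Fin t × Bool)) {n : ℕ} (β : Fin n → Blk np k) (j : Fin n) : Finset (GKey t k) :=
  (Eloc pc (β j)).map (embed (posB pc β j).1 (posB pc β j).2)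

/-- **The global keys of a block word.** -/
def Eglob (pc : Fin np → List (Fin t × Bool)) {n : ℕ} (β : Fin n → Blk np k) : Finset (GKey t k) :=
  univ.biUnion (Ej pc β)

/-- Keys of block `j` carry the time position of block `j` … -/
theorem fst_of_mem_Ej {pc : Fin np → List (Fin t × Bool)} {n : ℕ} {β : Fin n → Blk np k} {j : Fin n} {g : GKey t k}
    (h : g ∈ Ej pc β j) : g.1 = (posB pc β j).1 := by
  obtain ⟨q, -, rfl⟩ := mem_map.1 h
  rfl

/-- … whose coordinates sum to `j`. -/
theorem sum_fst_of_mem_Ej {pc : Fin np → List (Fin t × Bool)} {n : ℕ} {β : Fin n → Blk np k} {j : Fin n}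
    {g : GKey t k} (h : g ∈ Ej pc β j) : ∑ a, g.1 a = (j : ℕ) := by
  rw [fst_of_mem_Ej h, sum_posB_fst pc β (le_of_lt j.2)]

/-- Keys of different blocks (of any two words) are disjoint. -/
theorem disjoint_Ej (pc : Fin np → List (Fin t × Bool)) {n : ℕ} (β β' : Fin n → Blk np k) {j j' : Fin n}
    (hjj : j ≠ j') : Disjoint (Ej pc β j) (Ej pc β' j') := by
  rw [Finset.disjoint_left]
  intro g h h'
  have h1 := sum_fst_of_mem_Ej h
  have h2 := sum_fst_of_mem_Ej h'
  rw [h1] at h2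
  exact hjj (Fin.ext (by exact_mod_cast h2))

/-- **Shared keys of block `j`**: `|Ej β j ∩ Ej β' j| = Rloc (offAt 0 β β' j) (β j) (β' j)`. -/
theorem card_Ej_inter (pc : Fin np → List (Fin t × Bool)) {n : ℕ} (β β' : Fin n → Blk np k) (j : Fin n) :
    (Ej pc β j ∩ Ej pc β' j).card = Rloc pc (offAt pc 0 β β' j) (β j) (β' j) := by
  rw [Rloc, offAt_zero_eq, Prod.fst_sub, Prod.snd_sub]
  by_cases hT : (posB pc β' j).1 - (posB pc β j).1 = 0
  · rw [if_pos hT]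
    have hTT : (posB pc β' j).1 = (posB pc β j).1 := sub_eq_zero.1 hT
    have hset : Ej pc β j ∩ Ej pc β' j =
        (Eloc pc (β j) ∩ (Eloc pc (β' j)).map (shiftE ((posB pc β' j).2 - (posB pc β j).2))).map
          (embed (posB pc β j).1 (posB pc β j).2) := by
      ext g
      simp only [Ej, mem_inter, mem_map, embed, shiftE, Function.Embedding.coeFn_mk]
      constructor
      · rintro ⟨⟨q, hq, rfl⟩, ⟨q', hq', hqq'⟩⟩
        simp only [Prod.mk.injEq] at hqq'
        obtain ⟨-, h1, h2⟩ := hqq'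
        refine ⟨q, ⟨hq, q', hq', ?_⟩, rfl⟩
        exact Prod.ext (by dsimp only; linear_combination h1) h2
      · rintro ⟨q, ⟨hq, q', hq', rfl⟩, rfl⟩
        refine ⟨⟨_, hq, rfl⟩, ⟨q', hq', ?_⟩⟩
        exact Prod.ext hTT (Prod.ext (by dsimp only; abel) rfl)
    rw [hset, card_map]
  · rw [if_neg hT, Finset.card_eq_zero, ← Finset.disjoint_iff_inter_eq_empty, Finset.disjoint_left]
    intro g h h'
    exact hT (by rw [← fst_of_mem_Ej h', ← fst_of_mem_Ej h, sub_self])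

/-- Common keys sit in common blocks. -/
theorem inter_Eglob (pc : Fin np → List (Fin t × Bool)) {n : ℕ} (β β' : Fin n → Blk np k) :
    Eglob pc β ∩ Eglob pc β' = univ.biUnion fun j => Ej pc β j ∩ Ej pc β' j := by
  ext g
  simp only [Eglob, mem_inter, mem_biUnion, mem_univ, true_and]
  constructor
  · rintro ⟨⟨j, hj⟩, ⟨j', hj'⟩⟩
    have hjj : j = j' := by
      have h1 := sum_fst_of_mem_Ej hj
      have h2 := sum_fst_of_mem_Ej hj'
      rw [h1] at h2
      exact Fin.ext (by exact_mod_cast h2)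
    subst hjj
    exact ⟨j, hj, hj'⟩
  · rintro ⟨j, hj, hj'⟩
    exact ⟨⟨j, hj⟩, ⟨j, hj'⟩⟩

/-- **Shared keys of two block words**: `|Eglob β ∩ Eglob β'| = Ksh Rloc pc 0 β β'`. -/
theorem card_inter_Eglob (pc : Fin np → List (Fin t × Bool)) {n : ℕ} (β β' : Fin n → Blk np k) :
    (Eglob pc β ∩ Eglob pc β').card = Ksh (Rloc pc) pc 0 β β' := by
  rw [inter_Eglob, card_biUnion]
  · exact sum_congr rfl fun j _ => card_Ej_inter pc β β' j
  · intro j _ j' _ hjj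
    exact (disjoint_Ej pc β β' hjj).mono inter_subset_left inter_subset_right

/-! ### The open path along a block word -/

/-- Step vectors are nonzero. -/
theorem sv_ne_zero (q : Fin t × Bool) : sv q ≠ (0 : Fin t → ℤ) := by
  intro h
  have := congr_fun h q.1
  by_cases hb : q.2 = true <;> simp [sv, hb] at this

/-- The edge of the key of a transverse step joins its two endpoints. -/
theorem gedge_step (T : Fin k → ℤ) (X u : Fin t → ℤ) (q : Fin t × Bool) :
    gedge (T, ((if q.2 then (u, (Sum.inl q.1 : Fin t ⊕ Fin k)) else (u + sv q, Sum.inl q.1)).1 + X,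
      (if q.2 then (u, (Sum.inl q.1 : Fin t ⊕ Fin k)) else (u + sv q, Sum.inl q.1)).2)) =
      s(ι (T, X + u), ι (T, X + u + sv q)) := by
  have hax : ι (axisVec (Sum.inl q.1 : Fin t ⊕ Fin k)) = ι (((0 : Fin k → ℤ), (Pi.single q.1 (1 : ℤ))) : Off t k) := rfl
  by_cases hq : q.2 = true
  · have hsv : sv q = Pi.single q.1 1 := by funext i; simp [sv, hq]
    simp only [hq, if_true]
    rw [gedge]
    dsimp only
    rw [hax, ← ι_add]
    have e2 : ((T, u + X) : Off t k) + ((0 : Fin k → ℤ), Pi.single q.1 (1 : ℤ)) = (T, X + u + sv q) :=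
      Prod.ext (by simp) (by rw [hsv]; change u + X + Pi.single q.1 1 = X + u + Pi.single q.1 1; abel)
    have e1 : ((T, u + X) : Off t k) = (T, X + u) := Prod.ext rfl (add_comm _ _)
    rw [e2, e1]
  · have hsv : sv q = -Pi.single q.1 1 := by
      funext i; simp [sv, hq, Pi.single_apply, Pi.neg_apply]; split_ifs <;> simp
    simp only [hq, if_false, Bool.false_eq_true]
    rw [gedge]
    dsimp only
    rw [hax, ← ι_add, Sym2.eq_swap]
    have e2 : ((T, u + sv q + X) : Off t k) + ((0 : Fin k → ℤ), Pi.single q.1 (1 : ℤ)) = (T, X + u) :=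
      Prod.ext (by simp) (by rw [hsv]; change u + -Pi.single q.1 1 + X + Pi.single q.1 1 = X + u; abel)
    have e1 : ((T, u + sv q + X) : Off t k) = (T, X + u + sv q) := Prod.ext rfl (by change u + sv q + X = X + u + sv q; abel)
    rw [e2, e1]

/-- **Walking a piece**: if the keys of the transverse steps are open, there is an open path along the piece. -/
theorem pathIn_piece (ω : BondConfig (Site (k + t))) (T : Fin k → ℤ) (X : Fin t → ℤ) :
    ∀ (σ : List (Fin t × Bool)) (u : Fin t → ℤ),
      (∀ q ∈ tedges k u σ, gedge (T, (q.1 + X, q.2)) ∈ ω) →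
      PathIn (openGraph ω) Set.univ (ι (T, X + u)) (ι (T, X + u + (σ.map sv).sum))
  | [], u, _ => by simpa using PathIn.refl (Set.mem_univ _)
  | q :: σ, u, h => by
    have hkey : gedge (T, ((if q.2 then (u, (Sum.inl q.1 : Fin t ⊕ Fin k)) else (u + sv q, Sum.inl q.1)).1 + X,
        (if q.2 then (u, (Sum.inl q.1 : Fin t ⊕ Fin k)) else (u + sv q, Sum.inl q.1)).2)) ∈ ω :=
      h _ (by rw [tedges]; exact mem_insert_self _ _)
    rw [gedge_step] at hkey
    have hadj : (openGraph ω).Adj (ι (T, X + u)) (ι (T, X + u + sv q)) := by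
      rw [openGraph_adj]
      refine ⟨hkey, fun heq => sv_ne_zero q ?_⟩
      have := ι_injective heq
      have := congr_arg Prod.snd this
      simpa using this
    have hrest := pathIn_piece ω T X σ (u + sv q) (fun q' hq' => h q' (by rw [tedges]; exact mem_insert_of_mem hq'))
    have e1 : X + (u + sv q) = X + u + sv q := by abel
    have e2 : X + u + sv q + (σ.map sv).sum = X + u + ((q :: σ).map sv).sum := by
      simp only [List.map_cons, List.sum_cons]; abel
    rw [e1, e2] at hrest
    exact ⟨Set.mem_univ _, Relation.ReflTransGen.head ⟨hadj, Set.mem_univ _⟩ hrest.2⟩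

/-- One more block: `posB β (j+1) = posB β j + dsp (β j)` for `j < n`. -/
theorem posB_succ (pc : Fin np → List (Fin t × Bool)) {n : ℕ} (β : Fin n → Blk np k) {j : ℕ} (hj : j < n) :
    posB pc β (j + 1) = posB pc β j + dsp pc (β ⟨j, hj⟩) := by
  unfold posB
  have hsplit : ∀ i : Fin n, (if (i : ℕ) < j + 1 then dsp pc (β i) else 0) =
      (if (i : ℕ) < j then dsp pc (β i) else 0) + (if i = ⟨j, hj⟩ then dsp pc (β ⟨j, hj⟩) else 0) := by
    intro i
    by_cases hi : i = ⟨j, hj⟩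
    · subst hi; simp
    · have hne : (i : ℕ) ≠ j := fun h => hi (Fin.ext h)
      have : ((i : ℕ) < j + 1) ↔ ((i : ℕ) < j) := by omega
      rw [if_neg hi, add_zero]; exact if_congr this rfl rfl
  simp_rw [hsplit]
  rw [sum_add_distrib, sum_ite_eq']
  simp

/-- **The open path along a block word**: if all its keys are open, the origin is joined by an open lattice path to
the start of block `j` for every `j ≤ n`. -/
theorem pathIn_blocks (pc : Fin np → List (Fin t × Bool)) {n : ℕ} (β : Fin n → Blk np k)
    {ω : BondConfig (Site (k + t))} (hω : ∀ g ∈ Eglob pc β, gedge g ∈ ω) :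
    ∀ j, j ≤ n → PathIn (openGraph ω) Set.univ (0 : Site (k + t)) (ι (posB pc β j))
  | 0, _ => by
    have : posB pc β 0 = 0 := by simp [posB]
    rw [this, ι_zero]; exact PathIn.refl (Set.mem_univ _)
  | j + 1, hj => by
    have hj' : j < n := Nat.lt_of_succ_le hj
    have ih := pathIn_blocks pc β hω j hj'.le
    have hkeys : ∀ q ∈ Eloc pc (β ⟨j, hj'⟩), gedge ((posB pc β j).1, (q.1 + (posB pc β j).2, q.2)) ∈ ω := by
      intro q hq
      exact hω _ (mem_biUnion.2 ⟨⟨j, hj'⟩, mem_univ _, mem_map.2 ⟨q, hq, rfl⟩⟩)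
    -- along the piece
    have h1 : PathIn (openGraph ω) Set.univ (ι (posB pc β j))
        (ι ((posB pc β j).1, (posB pc β j).2 + pend (pc (β ⟨j, hj'⟩).1))) := by
      have := pathIn_piece ω (posB pc β j).1 (posB pc β j).2 (pc (β ⟨j, hj'⟩).1) 0
        (fun q hq => hkeys q (by rw [Eloc]; exact mem_insert_of_mem hq))
      simpa [pend] using this
    -- the time step
    have hkey : gedge ((posB pc β j).1, (pend (pc (β ⟨j, hj'⟩).1) + (posB pc β j).2, Sum.inr (β ⟨j, hj'⟩).2)) ∈ ω :=
      hkeys _ (by rw [Eloc]; exact mem_insert_self _ _)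
    have hend : ι ((posB pc β j).1, pend (pc (β ⟨j, hj'⟩).1) + (posB pc β j).2) +
        ι (axisVec (Sum.inr (β ⟨j, hj'⟩).2 : Fin t ⊕ Fin k)) = ι (posB pc β (j + 1)) := by
      rw [posB_succ pc β hj', ← ι_add]
      congr 1
      refine Prod.ext ?_ ?_
      · simp [axisVec, dsp]
      · simp [axisVec, dsp, add_comm]
    have hadj : (openGraph ω).Adj (ι ((posB pc β j).1, (posB pc β j).2 + pend (pc (β ⟨j, hj'⟩).1)))
        (ι (posB pc β (j + 1))) := by
      rw [openGraph_adj, ← hend, show (posB pc β j).2 + pend (pc (β ⟨j, hj'⟩).1) =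
        pend (pc (β ⟨j, hj'⟩).1) + (posB pc β j).2 from add_comm _ _]
      refine ⟨hkey, fun heq => ?_⟩
      have h0 : ι (axisVec (Sum.inr (β ⟨j, hj'⟩).2 : Fin t ⊕ Fin k)) = 0 := by
        have := congr_arg (fun z => z - ι ((posB pc β j).1, pend (pc (β ⟨j, hj'⟩).1) + (posB pc β j).2)) heq
        simpa using this.symm
      have := congr_arg (fun z : Site (k + t) => ∑ i, z i) h0
      rw [sum_ι_axisVec] at this
      simp at this
    exact ih.trans (h1.tail hadj (Set.mem_univ _))

end Summit.CriticalPhenomena.PercolationContinuityZ3.Theorems.Pcint.BSM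

end
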